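import Summits.ABC.IUTFork.ForkLocalGlobalWitness
import Summits.ABC.IUTFork.Cor312TeamAGapWitness
import Summits.ABC.IUTFork.Cor312LogKummerRoute
import Summits.ABC.IUTFork.Cor312QFrobNotNecessary
import HarnessLib

/-!
# [IUTchIII] Cor. 3.12 — GLOBAL single-image volume transport is NOT NECESSARY for the typed Corollary

Record-only file (D-0012) of the abc-iut cell (wave-5 prover seat abc-iut-w5-d232; ADJUDICATION support piece for
HUMAN RULING D-0067, `HOME/plan/ADJUDICATION-SPEC.md` §2 (G1′) «QUANTIFIER LEVEL of the gap statement» / §4 (ii);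
complements abc-iut-w5-d087's `Cor312QFrobNotNecessary` (per-packet level) and records the audit of
abc-iut-w4-d022's `Cor312LogKummerRouteGlobal` (p413209)); TAKES NO SIDE; proof-only plus witness definitions;
fact-free. [claim: Mochizuki2012, status: disputed] for the Corollary; everything proved here is bookkeeping.

QUESTION. Team B's log-Kummer route (`Cor312LogKummerRoute`, abc-iut-c312-11) derives the printed Statement of
[IUTchIII] Cor. 3.12 (kurims `paper:url-4b091feeb646`, p. 174 l. 16–18) from the PER-PACKET input `VolumeTransport`;
p413209 `statement_of_globalVolumeTransport` lifts the route to print's quantifier level (Step (xi-g), p. 184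
l. 30–34: ONE comparison of two global reals): for SOME family of lattice positions `m(j, v_ℚ)` (finitely supported
Kummer-image log-volumes), `−|log(q)| ≤ procession-normalised ∑ᶠ_{v_ℚ} μ^log(thetaRegion (m j v_ℚ))` ⟹ Statement.
That input is global in quantifiers but phrased with SINGLE Kummer images, where print's `−|log(Θ)|` is the volume
of the holomorphic HULL (Step (xi-d), p. 183). Is it equivalent to the typed Corollary?

ANSWER (interface level, kernel-checked): NO — STRICTLY STRONGER (§§1–4, 6): an instantiation with typed Thm 3.11
(i) ∧ (ii) ∧ (iii) TRUE, every bridge hypothesis, `|log(q)| > 0`, admissible Kummer images, Kummer-exact column, the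
typed Corollary TRUE (`−|log(Θ)| = −|log(q)| = −1`) — and the global single-image inequality FALSE FOR EVERY family of
lattice positions (every right-hand side is `−2`), as is the per-packet `VolumeTransport`. Mechanism: at the label
`2` the Kummer image at position `m` is the ONE-POINT region `{0}` (`m = 0`) or `{x}`, `x ≠ 0` (`m ≠ 0`); the
log-volume is `−3` on one-point regions and `−1` on regions with two distinct points (monotone); every single image
has volume `−3`, the (Ind3)-union `{0, x}` — hence the hull — has volume `−1 =` the `q`-pilot volume. Sums of
single-image volumes do not control hull volumes. And (§5, on w5-d087's `qfSetting`) the other arrow is strict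
too: global ⇍ per-packet. So per-packet ⟹ global ⟹ Statement with BOTH arrows strict at interface level; with
Team A's `GapWitness.thm311_bridgeHyps_not_imp_statement` the global input is independent of {typed Thm 3.11,
BridgeHyps, `|log(q)| > 0`, admissibility}; the Statement-equivalent form is the HULL-level `GapGlobal` of
abc-iut-skel (`gapGlobal_iff_statement`). Nothing here concerns the assembled REAL setting (`Setting.ofComparison`,
`Cor312Prov.IsSettingOf`); that is the teams' adjudication.

Witness data = the cell's landed toys: c312-7's `toyShells`/`toySig`, the skeleton's nonempty hull frame `lgFrame`
(ForkLocalGlobalWitness), Team A's `gapDegrees`/`gapLink`/`packetEquiv` (Cor312TeamAGapWitness). [folklore]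
-/

noncomputable section
namespace Summit.ABC.IUTFork.Cor312Vol.GlobalTransportWitness
open Thm311 Cor312 Cor312.Checks Literature.IUT.LogThetaLattice LocalGlobal GapWitness
open QFrobWitness (sum_fin_lstar)

/-! ## 1. Data: log-volume `−3` on one-point regions, `−1` on regions with two distinct points -/

open scoped Classical in
/-- The log-volume of the witness: `−3` on subsingleton regions, `−1` on regions with two distinct points. [folklore] -/
def gtVol (j : toyIndex.Label) (vQ : toyIndex.VQ) (A : Set (toyShells.Packet j vQ)) : ℝ :=
  if A.Subsingleton then -3 else -1

/-- `gtVol` of a subsingleton region is `−3`. [folklore] -/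
theorem gtVol_of_subsingleton {j : toyIndex.Label} {vQ : toyIndex.VQ} {A : Set (toyShells.Packet j vQ)}
    (h : A.Subsingleton) : gtVol j vQ A = -3 := if_pos h

/-- `gtVol` of a region with two distinct points is `−1`. [folklore] -/
theorem gtVol_of_not_subsingleton {j : toyIndex.Label} {vQ : toyIndex.VQ} {A : Set (toyShells.Packet j vQ)}
    (h : ¬ A.Subsingleton) : gtVol j vQ A = -1 := if_neg h

/-- The whole (nontrivial) packet has `gtVol = −1`. [folklore] -/
theorem gtVol_univ (j : toyIndex.Label) (vQ : toyIndex.VQ) : gtVol j vQ Set.univ = -1 := by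
  haveI := packet_nontrivial j vQ
  exact gtVol_of_not_subsingleton (by rw [Set.subsingleton_univ_iff]; exact not_subsingleton _)

/-- `gtVol` is monotone on all regions. [folklore] -/
theorem gtVol_mono {j : toyIndex.Label} {vQ : toyIndex.VQ} {A B : Set (toyShells.Packet j vQ)} (hAB : A ⊆ B) :
    gtVol j vQ A ≤ gtVol j vQ B := by
  by_cases hB : B.Subsingleton
  · rw [gtVol_of_subsingleton (hB.anti hAB), gtVol_of_subsingleton hB]
  · rw [gtVol_of_not_subsingleton hB]
    unfold gtVol
    split_ifs <;> norm_num

/-- Data (a)(b)(c) of the witness: everything admissible, log-volume `gtVol`, nothing else. [folklore] -/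
def gtData : MRData toyShells where
  shellPk := fun _ _ => Set.univ
  shellSub := fun _ _ => Set.univ
  Adm := fun _ _ _ => True
  logvol := fun j vQ A => gtVol j vQ A
  Ψ := fun _ _ => ∅
  act := fun _ _ _ => 0
  Mmod := fun _ => ∅

/-- The witness situation: toy shells, `gtData` on every line, Team A's degree-`(−1)` objects. [folklore] -/
def gtSituation : Situation toyIndex where
  L := toyShells
  D := fun _ => gtData
  G := fun _ j => gapDegrees j

/-- A Kummer-EXACT column: the Frobenioid-side readings at every `(n, m)` ARE the data of `gtData`. [folklore] -/
def gtColumn : Column toyShells where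
  frobAdm := fun _ _ _ _ => True
  frobLogvol := fun _ j vQ A => gtVol j vQ A
  frobΨ := fun _ _ _ => ∅
  frobMmod := fun _ _ => ∅
  unitImage := fun _ _ _ _ => Set.univ
  ballImage := fun _ _ _ => Set.univ
  ObjLGP := Unit
  frobObjLGP := fun _ => Unit
  kumLGP := fun _ => Equiv.refl Unit
  ObjLgp := Unit
  frobObjLgp := fun _ => Unit
  kumLgp := fun _ => Equiv.refl Unit
  thetaPilot := fun _ => ()

/-- The full witness situation: the Kummer-exact column on every line, Team A's link data. [folklore] -/
def gtFull : FullSituation toyIndex where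
  toSituation := gtSituation
  col := fun _ => gtColumn
  link := gapLink

/-- (ii) (a) holds for the witness column against the witness data. [folklore] -/
theorem gtColumn_kummerA : gtColumn.KummerA gtData := fun _ _ _ _ _ => ⟨trivial, rfl⟩

/-! ## 2. The typed Theorem 3.11 holds in the witness -/

/-- (i) holds: empty splitting monoids, degree clause `−1 = −1` (`gtVol_univ`), constant vertical data. [folklore] -/
theorem gt_partI : gtFull.PartI := by
  refine ⟨fun n v hv x hx => absurd hx (Set.notMem_empty x), fun n j J => ⟨fun _ => trivial, ?_, ?_⟩,
    fun n n' => rfl⟩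
  · exact Set.toFinite _
  · show (-1 : ℝ) = ∑ᶠ vQ : toyIndex.VQ, gtVol j.1 vQ Set.univ
    simp only [gtVol_univ]
    rw [finsum_unique]

/-- (ii) holds column by column (Kummer-exact column, unit images in the integral structures). [folklore] -/
theorem gt_partII : gtFull.toLatticeSituation.PartII := by
  intro n
  refine (Column.partII_iff _ _).2 ⟨gtColumn_kummerA, fun _ _ _ => rfl, fun _ _ => rfl, ?_⟩
  exact ⟨fun m m' j vQ _ => Set.subset_univ _, fun m j vQ h => absurd trivial h⟩

/-- (iii) holds: the link data are Team A's `gapLink` (`gap_partIII`); the (Ind) clause follows from (i). [folklore] -/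
theorem gt_partIII : gtFull.PartIII :=
  ⟨gap_partIII.1, gap_partIII.2.1, gap_partIII.2.2.1, gap_partIII.2.2.2.1,
    gtFull.evalCompatUpToInd_of_multiradialCompat gt_partI.2.2⟩

/-- **The typed Theorem 3.11 (i) ∧ (ii) ∧ (iii) HOLDS in the witness.** [folklore] -/
theorem gtFull_statement : Summit.ABC.IUTFork.Thm311.FullSituation.Statement gtFull :=
  ⟨gt_partI, gt_partII, gt_partIII⟩

/-! ## 3. The setting: one-point Kummer images `{0}` (`m = 0`) and `{x}` (`m ≠ 0`) at the label `2` -/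

/-- A nonzero element of the (nontrivial) toy packet: the image of `1 ∈ ℚ` under Team A's `packetEquiv`. [folklore] -/
def xNZ (j : toyIndex.Label) (vQ : toyIndex.VQ) : toyShells.Packet j vQ := (packetEquiv j vQ).symm 1

/-- `xNZ ≠ 0`. [folklore] -/
theorem xNZ_ne_zero (j : toyIndex.Label) (vQ : toyIndex.VQ) : xNZ j vQ ≠ 0 :=
  (packetEquiv j vQ).symm.map_ne_zero_iff.2 one_ne_zero

open scoped Classical in
/-- The point carried by the Kummer image at lattice position `m`: `0` for `m = 0`, `xNZ` otherwise. [folklore] -/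
def gtPoint (m : ℤ) (j : toyIndex.Label) (vQ : toyIndex.VQ) : toyShells.Packet j vQ :=
  if m = 0 then 0 else xNZ j vQ

/-- The WITNESS SETTING over `gtSituation` (column `n = 0`): at the label `2` the Kummer image of the Θ-pilot object at
position `m` is the one-point region `{gtPoint m}` (`{0}` at `m = 0`, `{x}` with `x ≠ 0` otherwise), everything at
the other labels; the `q`-pilot image is everything; nonempty hull frame `lgFrame`; c312-7's one-point data. [folklore] -/
def gtSetting : Setting gtSituation where
  n := 0
  HT := ℤ × ℤ
  LogLink := fun _ _ => Unit
  IsFull := fun _ => True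
  lattice :=
    { theater := fun n m => (n, m)
      distinct := fun p q h => by simpa using h
      logLink := fun _ _ => ()
      logLink_full := fun _ _ => trivial }
  Frd := Unit
  IsoF := fun _ _ => Unit
  Ob := fun _ => Unit
  realify := id
  Strip := Unit
  IsoS := fun _ _ => Unit
  M := fun _ _ => Unit
  sig := toySig
  split := { Msplit := fun _ _ => ⊤, exists_gen := fun _ _ => ⟨⟨(), trivial⟩, top_unit_isGenerator _⟩ }
  ObΔ := Unit
  N := fun _ _ => Unit
  qData := { q := fun _ _ => (), q_gen := fun _ _ => unit_isGenerator _, objOf := fun _ => () }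
  frame := fun _ _ => lgFrame _
  hul_adm := fun _ _ _ _ => trivial
  thetaRegionOf := fun m _ j vQ => if j = 2 then {gtPoint m j vQ} else Set.univ
  qRegionOf := fun _ _ _ => Set.univ
  qRegion_mem := fun _ _ => Set.univ_nonempty
  qSupport_finite := fun _ => Set.toFinite _

/-- The Kummer image at lattice position `m`: `{gtPoint m}` at the label `2`, everything elsewhere. [folklore] -/
theorem gt_thetaRegion (m : ℤ) (j : toyIndex.Label) (vQ : toyIndex.VQ) :
    gtSetting.thetaRegion m j vQ = if j = 2 then {gtPoint m j vQ} else Set.univ := rfl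

/-- The point `gtPoint m` lies in the Kummer image at `m`. [folklore] -/
theorem gtPoint_mem_thetaRegion (m : ℤ) (j : toyIndex.Label) (vQ : toyIndex.VQ) :
    gtPoint m j vQ ∈ gtSetting.thetaRegion m j vQ := by
  rw [gt_thetaRegion]
  split_ifs
  · exact Set.mem_singleton _
  · exact Set.mem_univ _

/-- The (Ind3)-enlarged region is nonempty. [folklore] -/
theorem gt_thetaRegion3_nonempty (j : toyIndex.Label) (vQ : toyIndex.VQ) :
    (gtSetting.thetaRegion3 j vQ).Nonempty :=
  ⟨gtPoint 0 j vQ, Set.mem_iUnion.2 ⟨0, gtPoint_mem_thetaRegion 0 j vQ⟩⟩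

/-- `0` and `x ≠ 0` lie in the packet hull (Kummer images at `m = 0, 1`): the hull is no subsingleton. [folklore] -/
theorem gt_thetaHull_not_subsingleton (j : toyIndex.Label) (vQ : toyIndex.VQ) :
    ¬ (gtSetting.thetaHull j vQ).Subsingleton := by
  intro h
  have h0 : (0 : toyShells.Packet j vQ) ∈ gtSetting.thetaHull j vQ := by
    have := thetaRegion_subset_thetaHull gtSetting 0 j vQ (gtPoint_mem_thetaRegion 0 j vQ)
    rwa [show gtPoint 0 j vQ = 0 from if_pos rfl] at this
  have h1 : xNZ j vQ ∈ gtSetting.thetaHull j vQ := by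
    have := thetaRegion_subset_thetaHull gtSetting 1 j vQ (gtPoint_mem_thetaRegion 1 j vQ)
    rwa [show gtPoint 1 j vQ = xNZ j vQ from if_neg one_ne_zero] at this
  exact xNZ_ne_zero j vQ (h h1 h0)

/-- Every union of possible images admits its hull in the nonempty frame. [folklore] -/
theorem gt_hullDefined (j : toyIndex.Label) (vQ : toyIndex.VQ) : gtSetting.HullDefined j vQ :=
  ⟨trivial, (gt_thetaRegion3_nonempty j vQ).mono
    (Set.subset_sUnion_of_mem (gtSetting.thetaRegion3_mem_possibleImages j vQ))⟩

/-- The local Θ-volume of the witness is `−1` at every label (the hull has two distinct points). [folklore] -/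
theorem gt_thetaLocal (j : toyIndex.Label) (vQ : toyIndex.VQ) :
    gtSetting.thetaLocal j vQ = ((-1 : ℝ) : WithTop ℝ) := by
  unfold Setting.thetaLocal
  rw [if_pos (gt_hullDefined j vQ)]
  show ((gtVol j vQ (gtSetting.thetaHull j vQ) : ℝ) : WithTop ℝ) = _
  rw [gtVol_of_not_subsingleton (gt_thetaHull_not_subsingleton j vQ)]

/-- The local `q`-volume of the witness is `−1` at every label. [folklore] -/
theorem gt_qLocal (j : toyIndex.Label) (vQ : toyIndex.VQ) : gtSetting.qLocal j vQ = -1 :=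
  gtVol_univ j vQ

/-- The witness is `ThetaFinite`. [folklore] -/
theorem gt_thetaFinite : gtSetting.ThetaFinite :=
  ⟨fun i vQ => by rw [gt_thetaLocal]; exact WithTop.coe_ne_top, fun _ => Set.toFinite _⟩

/-- `−|log(Θ)| = ((−1) + (−1))/2 = −1` in the witness. [folklore] -/
theorem gt_negLogTheta : gtSetting.negLogTheta = ((-1 : ℝ) : WithTop ℝ) := by
  rw [gtSetting.negLogTheta_eq_of_thetaFinite gt_thetaFinite]
  congr 1
  simp only [gt_thetaLocal, WithTop.untopD_coe, finsum_unique]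
  unfold processionNormalized
  rw [sum_fin_lstar]
  norm_num

/-- `−|log(q)| = ((−1) + (−1))/2 = −1` in the witness. [folklore] -/
theorem gt_negLogQ : gtSetting.negLogQ = -1 := by
  unfold Setting.negLogQ
  simp only [gt_qLocal, finsum_unique]
  unfold processionNormalized
  rw [sum_fin_lstar]
  norm_num

/-- **The typed Corollary 3.12 HOLDS in the witness** (`−1 ≤ −1`). [folklore] -/
theorem gt_statement : Summit.ABC.IUTFork.Cor312.Setting.Statement gtSetting :=
  (gtSetting.statement_iff_real gt_negLogTheta).mpr (by rw [gt_negLogQ])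

/-- "`|log(q)| > 0`" holds in the witness (`−|log(q)| = −1 < 0`). [folklore] -/
theorem gt_absLogQPos : Summit.ABC.IUTFork.Cor312.Setting.AbsLogQPos gtSetting := by
  show gtSetting.negLogQ < 0
  rw [gt_negLogQ]; norm_num

/-- **ALL bridge hypotheses of `Cor312StatementBridge` hold in the witness.** [folklore] -/
theorem gtSetting_bridgeHyps : Summit.ABC.IUTFork.Cor312Vol.BridgeHyps gtSetting where
  mono := fun _ _ _ _ _ _ hAB => gtVol_mono hAB
  image_adm := fun _ _ _ _ => trivial
  image_fin := fun _ => Set.toFinite _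
  hul_nonempty := fun _ _ _ hH => hH
  theta_nonempty := fun _ vQ => gt_thetaRegion3_nonempty _ vQ
  finite := gt_thetaFinite

/-- The Kummer images of the Θ-pilot object are admissible (everything is). [folklore] -/
theorem gt_thetaRegionsAdm : Summit.ABC.IUTFork.Cor312Vol.ThetaRegionsAdm gtSetting :=
  fun _ _ _ => trivial

/-- (ii) (a) for the column carrying the setting (`n = 0`) against the data of its line. [folklore] -/
theorem gt_kummerA : (gtFull.col gtSetting.n).KummerA (gtFull.D gtSetting.n) := gtColumn_kummerA

/-! ## 4. Every single Kummer image is volume-deficient at the label `2` -/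

/-- At the label `2` every single Kummer image is a one-point region, of volume `−3`. [folklore] -/
theorem gt_logvol_thetaRegion_two (m : ℤ) (vQ : toyIndex.VQ) :
    (gtSituation.D gtSetting.n).logvol (Setting.labelSucc iTwo) vQ
        (gtSetting.thetaRegion m (Setting.labelSucc iTwo) vQ) = -3 := by
  show gtVol _ vQ (gtSetting.thetaRegion m (Setting.labelSucc iTwo) vQ) = -3
  rw [gt_thetaRegion, if_pos labelSucc_iTwo]
  exact gtVol_of_subsingleton Set.subsingleton_singleton

/-- At the label `1` every single Kummer image is everything, of volume `−1`. [folklore] -/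
theorem gt_logvol_thetaRegion_one (m : ℤ) (vQ : toyIndex.VQ) :
    (gtSituation.D gtSetting.n).logvol (Setting.labelSucc iOne) vQ
        (gtSetting.thetaRegion m (Setting.labelSucc iOne) vQ) = -1 := by
  show gtVol _ vQ (gtSetting.thetaRegion m (Setting.labelSucc iOne) vQ) = -1
  rw [gt_thetaRegion, if_neg labelSucc_iOne_ne_two]
  exact gtVol_univ _ vQ

/-- **The GLOBAL single-image volume-transport inequality FAILS for EVERY family of lattice positions**: its
right-hand side is `((−1) + (−3))/2 = −2 < −1 = −|log(q)|`. [folklore] -/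
theorem gt_not_globalVolumeTransport (mf : Fin toyIndex.lstar → toyIndex.VQ → ℤ) :
    ¬ gtSetting.negLogQ ≤ processionNormalized fun i : Fin toyIndex.lstar => ∑ᶠ vQ : toyIndex.VQ,
      (gtSituation.D gtSetting.n).logvol (Setting.labelSucc i) vQ
        (gtSetting.thetaRegion (mf i vQ) (Setting.labelSucc i) vQ) := by
  intro h
  rw [gt_negLogQ] at h
  simp only [finsum_unique] at h
  unfold processionNormalized at h
  rw [sum_fin_lstar, gt_logvol_thetaRegion_one, gt_logvol_thetaRegion_two] at h
  norm_num at h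

/-- The per-packet B-input `VolumeTransport` fails too (label `2`: `−1 ≤ −3` is false). [folklore] -/
theorem gt_not_volumeTransport : ¬ Summit.ABC.IUTFork.Cor312Vol.VolumeTransport gtSetting := by
  intro h
  obtain ⟨m, hm⟩ := h iTwo ()
  rw [gt_qLocal, gt_logvol_thetaRegion_two] at hm
  norm_num at hm

/-! ## 5. The other strictness: global ⇍ per-packet (on abc-iut-w5-d087's `qfSetting`) -/

/-- In w5-d087's witness every single Kummer image has the log-volume of the packet hull. [folklore] -/
theorem qf_logvol_thetaRegion_eq (m : ℤ) (i : Fin toyIndex.lstar) (vQ : toyIndex.VQ) :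
    (QFrobWitness.qfSituation.D QFrobWitness.qfSetting.n).logvol (Setting.labelSucc i) vQ
        (QFrobWitness.qfSetting.thetaRegion m (Setting.labelSucc i) vQ) =
      (QFrobWitness.qfSetting.thetaLocal (Setting.labelSucc i) vQ).untopD 0 := by
  rw [thetaLocal_untopD QFrobWitness.qfSetting_bridgeHyps, QFrobWitness.qf_thetaHull,
    QFrobWitness.qf_thetaRegion3, QFrobWitness.qf_thetaRegion]

/-- There the GLOBAL inequality HOLDS for EVERY family (both sides `−2`); the per-packet input fails. [folklore] -/
theorem qf_globalVolumeTransport (mf : Fin toyIndex.lstar → toyIndex.VQ → ℤ) :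
    QFrobWitness.qfSetting.negLogQ ≤ processionNormalized fun i : Fin toyIndex.lstar => ∑ᶠ vQ : toyIndex.VQ,
      (QFrobWitness.qfSituation.D QFrobWitness.qfSetting.n).logvol (Setting.labelSucc i) vQ
        (QFrobWitness.qfSetting.thetaRegion (mf i vQ) (Setting.labelSucc i) vQ) := by
  simp only [qf_logvol_thetaRegion_eq, QFrobWitness.qf_thetaLocal, WithTop.untopD_coe, finsum_unique]
  unfold processionNormalized
  rw [QFrobWitness.qf_negLogQ, sum_fin_lstar, if_neg labelSucc_iOne_ne_two, if_pos labelSucc_iTwo]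
  norm_num

/-- **Global ⇍ per-packet**: the converse of p413209's `globalVolumeTransport_of_pointwise` is FALSE at interface
level (typed Thm 3.11, bridge hypotheses, `|log(q)| > 0`, admissibility all holding). [folklore] -/
theorem global_not_imp_pointwise :
    ∃ (T : ThetaIndex) (F : FullSituation T) (P : Setting F.toLatticeSituation.toSituation),
      Summit.ABC.IUTFork.Thm311.FullSituation.Statement F ∧ Summit.ABC.IUTFork.Cor312Vol.BridgeHyps P ∧
        Summit.ABC.IUTFork.Cor312.Setting.AbsLogQPos P ∧ Summit.ABC.IUTFork.Cor312Vol.ThetaRegionsAdm P ∧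
        (∀ mf : Fin T.lstar → T.VQ → ℤ, P.negLogQ ≤ processionNormalized fun i : Fin T.lstar => ∑ᶠ vQ : T.VQ,
          (F.D P.n).logvol (Setting.labelSucc i) vQ (P.thetaRegion (mf i vQ) (Setting.labelSucc i) vQ)) ∧
        ¬ Summit.ABC.IUTFork.Cor312Vol.VolumeTransport P :=
  ⟨toyIndex, QFrobWitness.qfFull, QFrobWitness.qfSetting, QFrobWitness.qfFull_statement,
    QFrobWitness.qfSetting_bridgeHyps, QFrobWitness.qf_absLogQPos, QFrobWitness.qf_thetaRegionsAdm,
    qf_globalVolumeTransport, QFrobWitness.qf_not_volumeTransport⟩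

/-! ## 6. The certificate, as one statement -/

/-- **GLOBAL SINGLE-IMAGE VOLUME TRANSPORT IS NOT NECESSARY FOR THE TYPED COROLLARY 3.12 (quantifier
certificate, interface level).** One instantiation in which the typed Theorem 3.11 (i) ∧ (ii) ∧ (iii) holds in
full, every bridge hypothesis holds, `|log(q)| > 0`, the Kummer images are admissible, the column is Kummer-exact,
the typed Corollary 3.12 HOLDS — and the global inequality of p413209's `statement_of_globalVolumeTransport` FAILS
FOR EVERY family of lattice positions (its finite-support side condition being satisfied), as does Team B's
per-packet `VolumeTransport`. With Team A's `GapWitness.thm311_bridgeHyps_not_imp_statement` the global single-image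
input is independent of the premises and STRICTLY STRONGER than the typed Corollary (ADJUDICATION-SPEC §2 (G1′) /
§4 (ii)); the Statement-equivalent form is the hull-level `GapGlobal`. Nothing about the real setting. [folklore] -/
theorem globalVolumeTransport_not_necessary :
    ∃ (T : ThetaIndex) (F : FullSituation T) (P : Setting F.toLatticeSituation.toSituation),
      Summit.ABC.IUTFork.Thm311.FullSituation.Statement F ∧
        Summit.ABC.IUTFork.Cor312Vol.BridgeHyps P ∧
        Summit.ABC.IUTFork.Cor312.Setting.AbsLogQPos P ∧
        Summit.ABC.IUTFork.Cor312Vol.ThetaRegionsAdm P ∧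
        (F.col P.n).KummerA (F.D P.n) ∧
        Summit.ABC.IUTFork.Cor312.Setting.Statement P ∧
        (∀ mf : Fin T.lstar → T.VQ → ℤ,
          (∀ i : Fin T.lstar, (Function.support fun vQ : T.VQ =>
            (F.D P.n).logvol (Setting.labelSucc i) vQ
              (P.thetaRegion (mf i vQ) (Setting.labelSucc i) vQ)).Finite) ∧
          ¬ P.negLogQ ≤ processionNormalized fun i : Fin T.lstar => ∑ᶠ vQ : T.VQ,
            (F.D P.n).logvol (Setting.labelSucc i) vQ
              (P.thetaRegion (mf i vQ) (Setting.labelSucc i) vQ)) ∧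
        ¬ Summit.ABC.IUTFork.Cor312Vol.VolumeTransport P :=
  ⟨toyIndex, gtFull, gtSetting, gtFull_statement, gtSetting_bridgeHyps, gt_absLogQPos, gt_thetaRegionsAdm,
    gt_kummerA, gt_statement, fun mf => ⟨fun _ => Set.toFinite _, gt_not_globalVolumeTransport mf⟩,
    gt_not_volumeTransport⟩

/-- **The typed Corollary does NOT imply the global single-image transport**: the converse of p413209's
`statement_of_globalVolumeTransport` is false at interface level. [folklore] -/
theorem statement_not_imp_globalVolumeTransport :
    ¬ ∀ (T : ThetaIndex) (S : Situation T) (P : Setting S),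
        Summit.ABC.IUTFork.Cor312Vol.BridgeHyps P → Summit.ABC.IUTFork.Cor312Vol.ThetaRegionsAdm P →
          Summit.ABC.IUTFork.Cor312.Setting.Statement P →
            ∃ mf : Fin T.lstar → T.VQ → ℤ,
              P.negLogQ ≤ processionNormalized fun i : Fin T.lstar => ∑ᶠ vQ : T.VQ,
                (S.D P.n).logvol (Setting.labelSucc i) vQ
                  (P.thetaRegion (mf i vQ) (Setting.labelSucc i) vQ) := by
  intro h
  obtain ⟨mf, hmf⟩ := h toyIndex gtSituation gtSetting gtSetting_bridgeHyps gt_thetaRegionsAdm gt_statement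
  exact gt_not_globalVolumeTransport mf hmf

end Summit.ABC.IUTFork.Cor312Vol.GlobalTransportWitness

end
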